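import Summits.QuantumFields.BalabanUV.Beta.D1BFx.TorusWeightJetsCombFree

/-!
# `BalabanUV.Beta.D1BFx.GhostSqrtLeg` — road «BF-x» for binder row D1, slot (K), chain step (S-GH) of `DICT-CHAIN-SPEC.md`, PART 1 «GH-SQRT»:
# THE BI-LAPLACIAN GHOST FUNCTIONAL OVER A SANDWICH LEG IS A ONE-LEG FUNCTIONAL — exact finite-matrix identities

HONEST DEPENDENCY (page 1, mandatory): continuum YM on T⁴ ⇐ BetaPertH ∧ nine spine estimates (0/9 proved); BetaPertH ⇐ (D1) ∧ (D4) ∧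
CAP+tail; G-an2-4 gates asym, D1 and NE2/3/4.  HONEST FRAMING (cell contract, verbatim): «discharging `BetaPertH` makes Bałaban's UV
stability UNCONDITIONAL — a real constructive-QFT result; it is NOT the continuum limit and NOT the Clay problem.»  THIS MODULE DISCHARGES
NOTHING of the wall: [folklore] finite-matrix trace algebra (cyclicity + three socket identities) about ARBITRARY square matrices; no object of
Bałaban's is named, no `def`, no `def … : Prop`, nothing cited, 0 sorry.  0 root-level binders discharged (hW ∕ hR-sockets ∕ hSX-socket ∕ D1Tel ∕
D1Rep = 0); NOT (K), NOT D1, NOT `BetaPertH`, NOT continuum, NOT Clay.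

ABSOLUTE RULE (cell charter, verbatim): «No internally-minted statement may enter as a cited fact. Every hypothesis is either kernel-proved in
this package or a verbatim quotation of a PUBLISHED theorem with page reference. The manuscript(s) under audit are NOT citable for their own
disputed steps — they are the thing under adjudication; programme-internal (2001/route/tribunal) claims are never citable.»

WHY (owner d1-p2 gen 14, `DICT-CHAIN-SPEC.md` v1.0.1 §1 (S-GH) + §3 (c) «GH-DICT», first refusal leaf-04 lineage).  On every coarse torus the ghost
sector of route T is the functional `hessT (Ĉ; (L̂²)ₛ, (L̂²)ₜ, (L̂²)ₛₜ)` of TB5-2c-A (`KGhostTerm.hessT_ghostTerm_Nhat`) over the BI-LAPLACIAN site words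
`(L̂²)ₛ = ĴₛL̂ + L̂Ĵₛ`, `(L̂²)ₛₜ = ĴₛₜL̂ + ĴₛĴₜ + ĴₜĴₛ + L̂Ĵₛₜ` with ONE sandwich leg `Ĉ = N̂(N̂ᵀL̂L̂N̂)⁻¹N̂ᵀ = n⁴•Ĝ′(1 − P̂)Ĝ′` (leaf-03's
`TorusWeightJetsCombFree.Chat_eq`; on `ℤ⁴`: `KGhostLeg.Cgh n a = n⁴·(Ggh ∘ Rgt ∘ Ggh)`), whereas the road's ghost kernel `GhostKernelComplete.PghQ` is a
ONE-LEG functional `hessKer (Ggh n a) 𝒱 𝒲`.  (S-GH) asks for the identity between the two with named remainder kernels.  This file is its algebraic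
core, stated once for arbitrary square matrices so that the owner can choose the currency (torus matrices before `p → ∞`, or `ℤ⁴` kernels):
given a leg `C`, a (scaled) «Laplacian» `K` and three SOCKET identities `C·K = G·R`, `K·C = R·G`, `K·C·K = R` (§1 derives them from
`G·(K + A) = 1 = (K + A)·G` and `R·G·A = 0 = A·G·R` for `C := G·R·G`, `K = c•L` — the shape of the tower equation `Ĝ′·(n²L̂ + (a∕n⁴)·sameBlk) = 1` and of
B1 `LandauMultiplierMean` «`(1 − P̂)Ĝ′` kills block constants»), the bi-Laplacian functional over the leg `c²•C` EQUALS an explicit combination of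
ONE-LEG words (§2), whose `R = 1` value is EXACTLY `2·hessT (G; c•V, c•V′, c•W)` (§3) — the one-loop ghost functional with leg `G`, loop weight `2`
and the first∕second site jets rescaled by `c` (`c = n²`: the END's ray letter `cK n = cgh n·n²`); the words with at least one `P = 1 − R` are the
(S-GH) remainder.  The special case `C = G·G`, `G·L = 1 = L·G` (§3 `hessT_sq_leg`) is the textbook «`−½·log det L² = −log det L` at the Hessian».

CONTENT (all [folklore]; `ι` a `Fintype` with `DecidableEq`; every matrix square over `ι`; `hessT X V V′ W = ½·(tr (X·W) − tr (X·V·(X·V′)))`).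
* §1 `sockets_of_sandwich` — with `K` the «scaled Laplacian» (`K = c•L`): from `G·(K + A) = 1`, `(K + A)·G = 1`, `R·G·A = 0`, `A·G·R = 0`:
  `(G·R·G)·K = G·R`, `K·(G·R·G) = R·G`, `K·((G·R·G)·K) = R`.
* §2 **`hessT_biLaplacian_of_sockets`** — for ANY `C G R K V V′ W` with the three sockets `C·K = G·R`, `K·C = R·G`, `K·(C·K) = R`:
  `hessT C (V·K + K·V) (V′·K + K·V′) (W·K + V·V′ + V′·V + K·W)
     = ½·(tr (R·G·W) + tr (G·R·W) + tr (C·(V·V′)) + tr (C·(V′·V)))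
       − ½·(tr (R·G·V·(R·G·V′)) + tr (C·V·(R·V′)) + tr (R·V·(C·V′)) + tr (G·R·V·(G·R·V′)))`   (scalar-free).
* §3 `hessT_rescale` (no hypothesis: the leg `c²•C` over the words of `L` = the leg `C` over the words of `K := c•L` with the jets `c•V, c•V′, c•W`);
  **`hessT_sandwich_leg`** (§1 ∘ §2 ∘ rescale: leg `c²•(G·R·G)`, words of `L`, inverse of `c•L + A`); `oneLegForm_eq_two_mul_hessT` (the §2 right member AT
  `R = 1`, `C = G·G` is `2·hessT G V V′ W`, no hypothesis); **`hessT_sq_leg`** (`G·L = 1 = L·G` ⊢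
  `hessT (G·G) (V·L + L·V) (V′·L + L·V′) (W·L + V·V′ + V′·V + L·W) = 2·hessT G V V′ W`); **`eightWords_split`** (no hypothesis: the eight words at
  `C := G·(1 − P)·G`, `R := 1 − P` = `2·hessT G V V′ W` − the SIXTEEN explicit `P`-words).
* §4 **THE TORUS INSTANCE** (the (S-GH) identity per coarse torus, BY NAME over `PeriodisedProjector` + `TorusWeightJetsCombFree`): `torus_sockets` (the four
  hypotheses of §3 hold for `G := Ĝ′ = Ghat`, `c := (m+1)²`, `L := L̂ = Lhat`, `A := (a∕(m+1)⁴)•Ŝ`, `R := 1 − P̂` — `AXhat_eq` + `Ghat_mul_AXhat` (the periodised tower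
  equation, Lemma 2.2.2) and `Rhat_mul_Gshat` ∕ `Shat_Ghat_Rhat` (periodised B1: `(1 − P̂)Ĝ′Ŝ = 0 = ŜĜ′(1 − P̂)`)), **`hessT_Chat_biLaplacian`**: for a basis `N` of `ker Ŝ`,
  `hessT (Chat s N) (V·L̂ + L̂·V) (V′·L̂ + L̂·V′) (W·L̂ + V·V′ + V′·V + L̂·W)` — the SECOND functional of `KGhostTerm.hessT_ghostTerm_Nhat` at `V := Ljet b`,
  `V′ := Ljet b′`, `W := Ljet₁₁ b b′` — EQUALS the eight one-leg words at `Ĝ′`, `1 − P̂`, jets `(m+1)²•V, (m+1)²•V′, (m+1)²•W` (via `Chat_eq`); **`hessT_Chat_biLaplacian_split`** (ρ-g14-2 display):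
  `= 2·hessT (Ĝ′; (m+1)²•V, (m+1)²•V′, (m+1)²•W) − (the sixteen P̂-words)`.
Exact-arithmetic oracle (random rational 5×5 matrices, all three identities exact): `HOME/b2b-balaban-beta-d1-formalise-leaf-04/g16/ghsqrt/check_sqrt.py`.
Unit `b2b-balaban-beta-d1-formalise-leaf-04` (gen 16), D1 formalisation swarm; journal INTENT 3 [D1LEAF04-G16-INTENT-3].
-/

namespace Summit.QuantumFields.BalabanUV.Beta.D1BFx.GhostSqrtLeg

open Matrix
open Literature.MathematicalPhysics.QuantumFieldTheory.Balaban1983to89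
open Literature.MathematicalPhysics.QuantumFieldTheory.Balaban1983to89.Beta
open Summit.QuantumFields.BalabanUV.Beta.D1BFx.MixedVarPackedHess (hessT)

variable {ι : Type*} [Fintype ι] [DecidableEq ι]

/-! ## §1 The three sockets of a sandwich leg -/

/-- [folklore] **THE SOCKETS OF A SANDWICH LEG.**  If `G` is the two-sided inverse of `K + A` (`K` the scaled Laplacian, `A` the averaging term) and the
«projector» `R` satisfies `R·G·A = 0 = A·G·R`, then the sandwich `G·R·G` reads `K` as: `(G·R·G)·K = G·R`, `K·(G·R·G) = R·G`, `K·((G·R·G)·K) = R`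
— the `A`-words are gone. -/
theorem sockets_of_sandwich (G R K A : Matrix ι ι ℝ) (hGK : G * (K + A) = 1) (hKG : (K + A) * G = 1)
    (hRGA : R * G * A = 0) (hAGR : A * G * R = 0) :
    G * R * G * K = G * R ∧ K * (G * R * G) = R * G ∧ K * (G * R * G * K) = R := by
  -- the two one-sided readings of the inverse: `G·K = 1 − G·A`, `K·G = 1 − A·G`
  have hGL : G * K = 1 - G * A := by
    rw [eq_sub_iff_add_eq, ← Matrix.mul_add, hGK]
  have hLG : K * G = 1 - A * G := by
    rw [eq_sub_iff_add_eq, ← Matrix.add_mul, hKG]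
  have h1 : G * R * G * K = G * R := by
    rw [Matrix.mul_assoc (G * R) G K, hGL, Matrix.mul_sub, Matrix.mul_one, Matrix.mul_assoc G R (G * A), ← Matrix.mul_assoc R G A, hRGA,
      Matrix.mul_zero, sub_zero]
  have h2 : K * (G * R * G) = R * G := by
    rw [Matrix.mul_assoc G R G, ← Matrix.mul_assoc K G (R * G), hLG, Matrix.sub_mul, Matrix.one_mul, Matrix.mul_assoc A G (R * G),
      ← Matrix.mul_assoc G R G, ← Matrix.mul_assoc A (G * R) G, ← Matrix.mul_assoc A G R, hAGR, Matrix.zero_mul, sub_zero]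
  refine ⟨h1, h2, ?_⟩
  rw [h1, ← Matrix.mul_assoc, hLG, Matrix.sub_mul, Matrix.one_mul, Matrix.mul_assoc A G R, ← Matrix.mul_assoc A G R, hAGR, sub_zero]

/-! ## §2 The bi-Laplacian functional over a leg with the three sockets (scalar-free) -/

omit [DecidableEq ι] in
/-- [folklore] **THE BI-LAPLACIAN GHOST FUNCTIONAL IS A ONE-LEG FUNCTIONAL (socket form).**  For ANY square matrices `C G R K V V′ W` with the sockets
`C·K = G·R`, `K·C = R·G`, `K·(C·K) = R`, the Hessian functional of the leg `C` over the bi-Laplacian words `V·K + K·V`, `V′·K + K·V′`,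
`W·K + V·V′ + V′·V + K·W` equals the displayed combination of one-leg words (trace cyclicity + the sockets; nothing else). -/
theorem hessT_biLaplacian_of_sockets (C G R K V V' W : Matrix ι ι ℝ)
    (h1 : C * K = G * R) (h2 : K * C = R * G) (h3 : K * (C * K) = R) :
    hessT C (V * K + K * V) (V' * K + K * V') (W * K + V * V' + V' * V + K * W)
      = (1 / 2) * ((R * G * W).trace + (G * R * W).trace + (C * (V * V')).trace + (C * (V' * V)).trace)
        - (1 / 2) * ((R * G * V * (R * G * V')).trace + (C * V * (R * V')).trace
            + (R * V * (C * V')).trace + (G * R * V * (G * R * V')).trace) := by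
  -- right-associated forms of the sockets (for rewriting inside right-associated words)
  have h1' : ∀ X : Matrix ι ι ℝ, C * (K * X) = G * (R * X) := fun X => by rw [← Matrix.mul_assoc, h1, Matrix.mul_assoc]
  have h2' : ∀ X : Matrix ι ι ℝ, K * (C * X) = R * (G * X) := fun X => by rw [← Matrix.mul_assoc, h2, Matrix.mul_assoc]
  have h3' : ∀ X : Matrix ι ι ℝ, K * (C * (K * X)) = R * X := fun X => by
    rw [← Matrix.mul_assoc C K X, ← Matrix.mul_assoc K (C * K) X, h3]
  -- TADPOLE WORDS
  have tW1 : (C * (W * K)).trace = (R * G * W).trace := by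
    rw [← Matrix.mul_assoc, Matrix.trace_mul_cycle, h2]
  have tW2 : (C * (K * W)).trace = (G * R * W).trace := by
    rw [← Matrix.mul_assoc, h1]
  -- BUBBLE WORDS
  have b1 : (C * (V * K) * (C * (V' * K))).trace = (R * G * V * (R * G * V')).trace := by
    have e : C * (V * K) * (C * (V' * K)) = (C * V * (K * C) * V') * K := by simp only [Matrix.mul_assoc]
    rw [e, Matrix.trace_mul_comm]
    congr 1
    simp only [Matrix.mul_assoc, h2']
  have b2 : (C * (V * K) * (C * (K * V'))).trace = (C * V * (R * V')).trace := by
    congr 1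
    simp only [Matrix.mul_assoc, h3']
  have b3 : (C * (K * V) * (C * (V' * K))).trace = (R * V * (C * V')).trace := by
    have e : C * (K * V) * (C * (V' * K)) = (C * (K * V) * (C * V')) * K := by simp only [Matrix.mul_assoc]
    rw [e, Matrix.trace_mul_comm]
    congr 1
    simp only [Matrix.mul_assoc, h3']
  have b4 : (C * (K * V) * (C * (K * V'))).trace = (G * R * V * (G * R * V')).trace := by
    congr 1
    simp only [Matrix.mul_assoc, h1']
  -- ASSEMBLY
  unfold hessT
  simp only [Matrix.mul_add, Matrix.add_mul, Matrix.trace_add]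
  rw [tW1, tW2, b1, b2, b3, b4]
  ring

/-! ## §3 Rescaling, the sandwich leg, the one-leg main term, the square-root special case -/

omit [DecidableEq ι] in
/-- [folklore] **RESCALING** (no hypothesis): the leg `c²•C` over the bi-Laplacian words of `L` equals the leg `C` over the bi-Laplacian words of the
scaled Laplacian `c•L` with the site jets rescaled to `c•V`, `c•V′`, `c•W`. -/
theorem hessT_rescale (C L V V' W : Matrix ι ι ℝ) (c : ℝ) :
    hessT (c ^ 2 • C) (V * L + L * V) (V' * L + L * V') (W * L + V * V' + V' * V + L * W)
      = hessT C ((c • V) * (c • L) + (c • L) * (c • V)) ((c • V') * (c • L) + (c • L) * (c • V'))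
          ((c • W) * (c • L) + (c • V) * (c • V') + (c • V') * (c • V) + (c • L) * (c • W)) := by
  unfold hessT
  simp only [Matrix.smul_mul, Matrix.mul_smul, Matrix.mul_add, Matrix.add_mul, smul_add, Matrix.trace_add, Matrix.trace_smul, smul_smul,
    smul_eq_mul]
  ring

/-- [folklore] **THE BI-LAPLACIAN GHOST FUNCTIONAL OVER THE SANDWICH LEG `c²•(G·R·G)`** — §2 at `C := G·R·G`, `K := c•L` after `hessT_rescale`, the
sockets supplied by §1 from `G·(c•L + A) = 1 = (c•L + A)·G` (two-sided inverse: the tower-equation shape) and `R·G·A = 0 = A·G·R` (the projector kills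
what the averaging term produces: the B1 shape).  The `A`-words are GONE; what remains are one-leg words in `G` with `R`'s inserted, the site jets
rescaled by `c`. -/
theorem hessT_sandwich_leg (G R L A V V' W : Matrix ι ι ℝ) (c : ℝ) (hGK : G * (c • L + A) = 1) (hKG : (c • L + A) * G = 1)
    (hRGA : R * G * A = 0) (hAGR : A * G * R = 0) :
    hessT (c ^ 2 • (G * R * G)) (V * L + L * V) (V' * L + L * V') (W * L + V * V' + V' * V + L * W)
      = (1 / 2) * ((R * G * (c • W)).trace + (G * R * (c • W)).trace + (G * R * G * ((c • V) * (c • V'))).trace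
            + (G * R * G * ((c • V') * (c • V))).trace)
        - (1 / 2) * ((R * G * (c • V) * (R * G * (c • V'))).trace + (G * R * G * (c • V) * (R * (c • V'))).trace
            + (R * (c • V) * (G * R * G * (c • V'))).trace + (G * R * (c • V) * (G * R * (c • V'))).trace) := by
  obtain ⟨h1, h2, h3⟩ := sockets_of_sandwich G R (c • L) A hGK hKG hRGA hAGR
  rw [hessT_rescale]
  exact hessT_biLaplacian_of_sockets (G * R * G) G R (c • L) (c • V) (c • V') (c • W) h1 h2 h3

/-- [folklore] **THE ONE-LEG MAIN TERM.**  The right member of §2 READ AT `R = 1`, `C = G·G` is EXACTLY twice the one-loop functional with the single leg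
`G`: `2·hessT G V V′ W` — no hypothesis (pure trace algebra).  In (S-GH): loop weight `2`, leg `Ĝ′`, jets rescaled by `c = n²` (the END's ray letter
`cK n = cgh n·n²`); the words of the full right member carrying at least one `P = 1 − R` are the remainder. -/
theorem oneLegForm_eq_two_mul_hessT (G V V' W : Matrix ι ι ℝ) :
    (1 / 2) * (((1 : Matrix ι ι ℝ) * G * W).trace + (G * 1 * W).trace + (G * G * (V * V')).trace + (G * G * (V' * V)).trace)
        - (1 / 2) * (((1 : Matrix ι ι ℝ) * G * V * ((1 : Matrix ι ι ℝ) * G * V')).trace + (G * G * V * ((1 : Matrix ι ι ℝ) * V')).trace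
            + ((1 : Matrix ι ι ℝ) * V * (G * G * V')).trace + (G * 1 * V * (G * 1 * V')).trace)
      = 2 * hessT G V V' W := by
  unfold hessT
  simp only [Matrix.one_mul, Matrix.mul_one]
  have e1 : (G * G * V * V').trace = (G * G * (V * V')).trace := by rw [Matrix.mul_assoc]
  have e2 : (V * (G * G * V')).trace = (G * G * (V' * V)).trace := by
    rw [Matrix.trace_mul_comm, Matrix.mul_assoc]
  rw [e1, e2]
  ring

/-- [folklore] **THE SQUARE-ROOT LEMMA** («`−½·log det L² = −log det L` at the Hessian»): for a two-sided inverse pair `G·L = 1 = L·G`, the Hessian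
functional of the leg `G·G` over the bi-Laplacian words of `L` is EXACTLY twice that of the leg `G` over the words of `L`:
`hessT (G·G) (V·L + L·V) (V′·L + L·V′) (W·L + V·V′ + V′·V + L·W) = 2·hessT G V V′ W`. -/
theorem hessT_sq_leg (G L V V' W : Matrix ι ι ℝ) (hGL : G * L = 1) (hLG : L * G = 1) :
    hessT (G * G) (V * L + L * V) (V' * L + L * V') (W * L + V * V' + V' * V + L * W) = 2 * hessT G V V' W := by
  have h1 : G * G * L = G * 1 := by rw [Matrix.mul_assoc, hGL]
  have h2 : L * (G * G) = 1 * G := by rw [← Matrix.mul_assoc, hLG]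
  have h3 : L * (G * G * L) = 1 := by rw [Matrix.mul_assoc, hGL, Matrix.mul_one, hLG]
  rw [hessT_biLaplacian_of_sockets (G * G) G 1 L V V' W h1 h2 h3]
  exact oneLegForm_eq_two_mul_hessT G V V' W

/-- [folklore] **THE SPLIT INTO THE ONE-LEG MAIN TERM AND THE `P`-REMAINDER** (no hypothesis; pure trace algebra).  The eight words of §2 at the sandwich
leg `C := G·(1 − P)·G`, `R := 1 − P` EQUAL `2·hessT G V V′ W` MINUS the SIXTEEN words carrying at least one `P` (four tadpole words, eight single-`P` and four
double-`P` bubble words, signs displayed).  With §4 this is the ρ-g14-2 display of the produced ghost sector: loop weight `2`, ONE leg `G`, plus the named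
`P`-remainder. -/
theorem eightWords_split (G P V V' W : Matrix ι ι ℝ) :
    (1 / 2) * (((1 - P) * G * W).trace + (G * (1 - P) * W).trace + (G * (1 - P) * G * (V * V')).trace + (G * (1 - P) * G * (V' * V)).trace)
        - (1 / 2) * (((1 - P) * G * V * ((1 - P) * G * V')).trace + (G * (1 - P) * G * V * ((1 - P) * V')).trace
            + ((1 - P) * V * (G * (1 - P) * G * V')).trace + (G * (1 - P) * V * (G * (1 - P) * V')).trace)
      = 2 * hessT G V V' W
        - ((1 / 2) * ((P * G * W).trace + (G * P * W).trace + (G * P * G * (V * V')).trace + (G * P * G * (V' * V)).trace)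
            - (1 / 2) * ((G * V * (P * G * V')).trace + (P * G * V * (G * V')).trace + (G * G * V * (P * V')).trace
                + (G * P * G * V * V').trace + (V * (G * P * G * V')).trace + (P * V * (G * G * V')).trace
                + (G * V * (G * P * V')).trace + (G * P * V * (G * V')).trace)
            + (1 / 2) * ((P * G * V * (P * G * V')).trace + (G * P * G * V * (P * V')).trace + (P * V * (G * P * G * V')).trace
                + (G * P * V * (G * P * V')).trace)) := by
  unfold hessT
  simp only [Matrix.sub_mul, Matrix.mul_sub, Matrix.one_mul, Matrix.mul_one, Matrix.trace_sub, Matrix.mul_assoc]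
  have e2 : (V * (G * (G * V'))).trace = (G * (G * (V' * V))).trace := by
    rw [Matrix.trace_mul_cycle' V G (G * V'), Matrix.trace_mul_cycle' (G * V') V G, Matrix.mul_assoc]
  rw [e2]
  ring

/-! ## §4 The torus instance: `Ĉ = (m+1)⁴•Ĝ′(1 − P̂)Ĝ′` over the bi-Laplacian words of `L̂` -/

section Torus

open Summit.QuantumFields.BalabanUV.Beta.D1BFx.PeriodisedProjector (Lhat Shat Phat Ghat AXhat AXhat_eq Ghat_mul_AXhat Gshat_eq Rhat_mul_Gshat
  Shat_Ghat_Rhat)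
open Summit.QuantumFields.BalabanUV.Beta.D1BFx.TorusWeightJetsCombFree (Chat Chat_eq)

variable (m : ℕ) {a : ℝ} (p : ℕ) [NeZero p]

/-- [folklore] **THE FOUR SOCKET HYPOTHESES OF §3 HOLD ON EVERY COARSE TORUS** for `G := Ĝ′`, `c := (m+1)²`, `L := L̂`, `A := (a∕(m+1)⁴)•Ŝ`, `R := 1 − P̂`:
the periodised tower equation `Ĝ′·((m+1)²L̂ + (a∕(m+1)⁴)Ŝ) = 1 = (…)·Ĝ′` (`AXhat_eq`, `Ghat_mul_AXhat`) and the periodised B1 `(1 − P̂)·Ĝ′·Ŝ = 0 = Ŝ·Ĝ′·(1 − P̂)`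
(`Rhat_mul_Gshat`, `Gshat_eq`, `Shat_Ghat_Rhat`). -/
theorem torus_sockets (ha : 0 < a) :
    Ghat m a ((m + 1) * p) * ((((m : ℝ) + 1) ^ 2) • Lhat ((m + 1) * p) + (a / ((m : ℝ) + 1) ^ 4) • Shat m ((m + 1) * p)) = 1
    ∧ ((((m : ℝ) + 1) ^ 2) • Lhat ((m + 1) * p) + (a / ((m : ℝ) + 1) ^ 4) • Shat m ((m + 1) * p)) * Ghat m a ((m + 1) * p) = 1
    ∧ (1 - Phat m a ((m + 1) * p)) * Ghat m a ((m + 1) * p) * ((a / ((m : ℝ) + 1) ^ 4) • Shat m ((m + 1) * p)) = 0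
    ∧ ((a / ((m : ℝ) + 1) ^ 4) • Shat m ((m + 1) * p)) * Ghat m a ((m + 1) * p) * (1 - Phat m a ((m + 1) * p)) = 0 := by
  have hAX := Ghat_mul_AXhat (m := m) (s := (m + 1) * p) ha rfl
  rw [AXhat_eq] at hAX
  refine ⟨hAX.1, hAX.2, ?_, ?_⟩
  · have h := Rhat_mul_Gshat (m := m) (a := a) (s := (m + 1) * p) ha rfl
    rw [Gshat_eq ha rfl, ← Matrix.mul_assoc] at h
    rw [Matrix.mul_smul, h, smul_zero]
  · have h := Shat_Ghat_Rhat (m := m) (a := a) (s := (m + 1) * p) ha rfl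
    rw [Matrix.smul_mul, Matrix.smul_mul, h, smul_zero]

/-- [folklore] **(S-GH) ON THE TORUS — THE BI-LAPLACIAN GHOST FUNCTIONAL OF ROUTE T IS A ONE-LEG FUNCTIONAL OF `Ĝ′`.**  For a basis `N` of `ker Ŝ`
(the hypotheses of `Chat_eq`) and ANY site jets `V V′ W` (the second functional of `KGhostTerm.hessT_ghostTerm_Nhat` is the instance `V := Ljet b`,
`V′ := Ljet b′`, `W := Ljet₁₁ b b′`):
`hessT (Ĉ; V·L̂ + L̂·V, V′·L̂ + L̂·V′, W·L̂ + V·V′ + V′·V + L̂·W)`, `Ĉ = N̂(N̂ᵀL̂L̂N̂)⁻¹N̂ᵀ`, EQUALS the eight one-leg words of §2 at leg `Ĝ′(1 − P̂)Ĝ′`, `G := Ĝ′`,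
`R := 1 − P̂`, jets `(m+1)²•V`, `(m+1)²•V′`, `(m+1)²•W`; by `oneLegForm_eq_two_mul_hessT` their `P̂ = 0` value is `2·hessT (Ĝ′; (m+1)²•V, (m+1)²•V′, (m+1)²•W)` —
ONE leg `Ĝ′`, loop weight `2`, jets rescaled by `(m+1)²`; the words with at least one `P̂` are the (S-GH) remainder ON THE TORUS.  (The `ℤ⁴` reading along
`p → ∞` is the existing TA3b socket `KGhostLeg.tendsto_hessT_Cgh` ∕ `TorusTraceTadpole.tendsto_hessT_hessKer` once the jets are periodised arrays — NOT done here.) -/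
theorem hessT_Chat_biLaplacian (ha : 0 < a) {ρ : Type*} [Fintype ρ] [DecidableEq ρ] {N : Matrix (Site 4 ((m + 1) * p)) ρ ℝ}
    (hN : ∀ lam : Site 4 ((m + 1) * p) → ℝ, Shat m ((m + 1) * p) *ᵥ lam = 0 ↔ ∃ c : ρ → ℝ, lam = N *ᵥ c)
    (hNinj : Function.Injective N.mulVec) (V V' W : Matrix (Site 4 ((m + 1) * p)) (Site 4 ((m + 1) * p)) ℝ) :
    hessT (Chat ((m + 1) * p) N)
        (V * Lhat ((m + 1) * p) + Lhat ((m + 1) * p) * V) (V' * Lhat ((m + 1) * p) + Lhat ((m + 1) * p) * V')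
        (W * Lhat ((m + 1) * p) + V * V' + V' * V + Lhat ((m + 1) * p) * W)
      = (1 / 2) * (((1 - Phat m a ((m + 1) * p)) * Ghat m a ((m + 1) * p) * ((((m : ℝ) + 1) ^ 2) • W)).trace
            + (Ghat m a ((m + 1) * p) * (1 - Phat m a ((m + 1) * p)) * ((((m : ℝ) + 1) ^ 2) • W)).trace
            + (Ghat m a ((m + 1) * p) * (1 - Phat m a ((m + 1) * p)) * Ghat m a ((m + 1) * p)
                * (((((m : ℝ) + 1) ^ 2) • V) * ((((m : ℝ) + 1) ^ 2) • V'))).trace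
            + (Ghat m a ((m + 1) * p) * (1 - Phat m a ((m + 1) * p)) * Ghat m a ((m + 1) * p)
                * (((((m : ℝ) + 1) ^ 2) • V') * ((((m : ℝ) + 1) ^ 2) • V))).trace)
        - (1 / 2) * (((1 - Phat m a ((m + 1) * p)) * Ghat m a ((m + 1) * p) * ((((m : ℝ) + 1) ^ 2) • V)
                * ((1 - Phat m a ((m + 1) * p)) * Ghat m a ((m + 1) * p) * ((((m : ℝ) + 1) ^ 2) • V'))).trace
            + (Ghat m a ((m + 1) * p) * (1 - Phat m a ((m + 1) * p)) * Ghat m a ((m + 1) * p) * ((((m : ℝ) + 1) ^ 2) • V)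
                * ((1 - Phat m a ((m + 1) * p)) * ((((m : ℝ) + 1) ^ 2) • V'))).trace
            + ((1 - Phat m a ((m + 1) * p)) * ((((m : ℝ) + 1) ^ 2) • V)
                * (Ghat m a ((m + 1) * p) * (1 - Phat m a ((m + 1) * p)) * Ghat m a ((m + 1) * p) * ((((m : ℝ) + 1) ^ 2) • V'))).trace
            + (Ghat m a ((m + 1) * p) * (1 - Phat m a ((m + 1) * p)) * ((((m : ℝ) + 1) ^ 2) • V)
                * (Ghat m a ((m + 1) * p) * (1 - Phat m a ((m + 1) * p)) * ((((m : ℝ) + 1) ^ 2) • V'))).trace) := by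
  obtain ⟨hGK, hKG, hRGA, hAGR⟩ := torus_sockets m p ha
  rw [Chat_eq m p ha hN hNinj, show ((m : ℝ) + 1) ^ 4 = (((m : ℝ) + 1) ^ 2) ^ 2 by ring]
  exact hessT_sandwich_leg (Ghat m a ((m + 1) * p)) (1 - Phat m a ((m + 1) * p)) (Lhat ((m + 1) * p))
    ((a / ((m : ℝ) + 1) ^ 4) • Shat m ((m + 1) * p)) V V' W (((m : ℝ) + 1) ^ 2) hGK hKG hRGA hAGR


/-- [folklore] **(S-GH) ON THE TORUS, ρ-g14-2 DISPLAY: `2·(ONE-LEG Ĝ′ FUNCTIONAL OF THE (m+1)²-RESCALED JETS) − (P̂-REMAINDER)`.**  `hessT_Chat_biLaplacian` composed with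
`eightWords_split` at `G := Ĝ′`, `P := P̂`, jets `(m+1)²•V, (m+1)²•V′, (m+1)²•W`: the bi-Laplacian ghost functional of route T over `Ĉ = N̂(N̂ᵀL̂L̂N̂)⁻¹N̂ᵀ` is
twice the one-loop functional with the single leg `Ĝ′` MINUS the sixteen explicit `P̂`-words (`P̂ = periodise₂ Pker`, the road's projector — it carries the block
averaging).  Nothing about `PghQ` ∕ the ray pins is asserted (PART 3 of GH-DICT). -/
theorem hessT_Chat_biLaplacian_split (ha : 0 < a) {ρ : Type*} [Fintype ρ] [DecidableEq ρ] {N : Matrix (Site 4 ((m + 1) * p)) ρ ℝ}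
    (hN : ∀ lam : Site 4 ((m + 1) * p) → ℝ, Shat m ((m + 1) * p) *ᵥ lam = 0 ↔ ∃ c : ρ → ℝ, lam = N *ᵥ c)
    (hNinj : Function.Injective N.mulVec) (V V' W : Matrix (Site 4 ((m + 1) * p)) (Site 4 ((m + 1) * p)) ℝ) :
    hessT (Chat ((m + 1) * p) N)
        (V * Lhat ((m + 1) * p) + Lhat ((m + 1) * p) * V) (V' * Lhat ((m + 1) * p) + Lhat ((m + 1) * p) * V')
        (W * Lhat ((m + 1) * p) + V * V' + V' * V + Lhat ((m + 1) * p) * W)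
      = 2 * hessT (Ghat m a ((m + 1) * p)) ((((m : ℝ) + 1) ^ 2) • V) ((((m : ℝ) + 1) ^ 2) • V') ((((m : ℝ) + 1) ^ 2) • W)
        - ((1 / 2) * ((Phat m a ((m + 1) * p) * Ghat m a ((m + 1) * p) * ((((m : ℝ) + 1) ^ 2) • W)).trace
              + (Ghat m a ((m + 1) * p) * Phat m a ((m + 1) * p) * ((((m : ℝ) + 1) ^ 2) • W)).trace
              + (Ghat m a ((m + 1) * p) * Phat m a ((m + 1) * p) * Ghat m a ((m + 1) * p)
                  * (((((m : ℝ) + 1) ^ 2) • V) * ((((m : ℝ) + 1) ^ 2) • V'))).trace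
              + (Ghat m a ((m + 1) * p) * Phat m a ((m + 1) * p) * Ghat m a ((m + 1) * p)
                  * (((((m : ℝ) + 1) ^ 2) • V') * ((((m : ℝ) + 1) ^ 2) • V))).trace)
            - (1 / 2) * ((Ghat m a ((m + 1) * p) * ((((m : ℝ) + 1) ^ 2) • V)
                    * (Phat m a ((m + 1) * p) * Ghat m a ((m + 1) * p) * ((((m : ℝ) + 1) ^ 2) • V'))).trace
                + (Phat m a ((m + 1) * p) * Ghat m a ((m + 1) * p) * ((((m : ℝ) + 1) ^ 2) • V)
                    * (Ghat m a ((m + 1) * p) * ((((m : ℝ) + 1) ^ 2) • V'))).trace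
                + (Ghat m a ((m + 1) * p) * Ghat m a ((m + 1) * p) * ((((m : ℝ) + 1) ^ 2) • V)
                    * (Phat m a ((m + 1) * p) * ((((m : ℝ) + 1) ^ 2) • V'))).trace
                + (Ghat m a ((m + 1) * p) * Phat m a ((m + 1) * p) * Ghat m a ((m + 1) * p) * ((((m : ℝ) + 1) ^ 2) • V)
                    * ((((m : ℝ) + 1) ^ 2) • V')).trace
                + (((((m : ℝ) + 1) ^ 2) • V) * (Ghat m a ((m + 1) * p) * Phat m a ((m + 1) * p) * Ghat m a ((m + 1) * p)
                    * ((((m : ℝ) + 1) ^ 2) • V'))).trace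
                + (Phat m a ((m + 1) * p) * ((((m : ℝ) + 1) ^ 2) • V)
                    * (Ghat m a ((m + 1) * p) * Ghat m a ((m + 1) * p) * ((((m : ℝ) + 1) ^ 2) • V'))).trace
                + (Ghat m a ((m + 1) * p) * ((((m : ℝ) + 1) ^ 2) • V)
                    * (Ghat m a ((m + 1) * p) * Phat m a ((m + 1) * p) * ((((m : ℝ) + 1) ^ 2) • V'))).trace
                + (Ghat m a ((m + 1) * p) * Phat m a ((m + 1) * p) * ((((m : ℝ) + 1) ^ 2) • V)
                    * (Ghat m a ((m + 1) * p) * ((((m : ℝ) + 1) ^ 2) • V'))).trace)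
            + (1 / 2) * ((Phat m a ((m + 1) * p) * Ghat m a ((m + 1) * p) * ((((m : ℝ) + 1) ^ 2) • V)
                    * (Phat m a ((m + 1) * p) * Ghat m a ((m + 1) * p) * ((((m : ℝ) + 1) ^ 2) • V'))).trace
                + (Ghat m a ((m + 1) * p) * Phat m a ((m + 1) * p) * Ghat m a ((m + 1) * p) * ((((m : ℝ) + 1) ^ 2) • V)
                    * (Phat m a ((m + 1) * p) * ((((m : ℝ) + 1) ^ 2) • V'))).trace
                + (Phat m a ((m + 1) * p) * ((((m : ℝ) + 1) ^ 2) • V)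
                    * (Ghat m a ((m + 1) * p) * Phat m a ((m + 1) * p) * Ghat m a ((m + 1) * p) * ((((m : ℝ) + 1) ^ 2) • V'))).trace
                + (Ghat m a ((m + 1) * p) * Phat m a ((m + 1) * p) * ((((m : ℝ) + 1) ^ 2) • V)
                    * (Ghat m a ((m + 1) * p) * Phat m a ((m + 1) * p) * ((((m : ℝ) + 1) ^ 2) • V'))).trace)) := by
  rw [hessT_Chat_biLaplacian m p ha hN hNinj]
  exact eightWords_split (Ghat m a ((m + 1) * p)) (Phat m a ((m + 1) * p)) ((((m : ℝ) + 1) ^ 2) • V) ((((m : ℝ) + 1) ^ 2) • V')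
    ((((m : ℝ) + 1) ^ 2) • W)

end Torus

end Summit.QuantumFields.BalabanUV.Beta.D1BFx.GhostSqrtLeg
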